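import Summits.CriticalPhenomena.PercolationContinuityZ3.Theorems.PercNearOneGluingNoHeavyQuantHalfMeanSmallBall
import HarnessLib

/-!
# QUANT lane R8, FAR on trees: the two-level inequality at the block's own layer ("top block") —
# the tight direction of the loose-hub-plus-block family is elementary

builds on p205010 (kernel theorem, internal audit signed; external expert review pending)

Support file (`--supports stmt-CriticalPhenomena-4575`), QUANT lane typer seat prim-quant-stmt (gen 10); memo
`run/shared/lean/prim/quant/prim-quant-stmt-g10/TLB-NOTES.md` §5.  Theorems only; no definitions, no sorries, standard axioms.

**Setting.**  The first tree family beyond the kernel for `Quant.FarRelayRow` / `Quant.FarTreeRow` is "loose hub + root block"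
(`prim-quant-lead-g6/LEAD-NOTES-G6.md` N14 (4)): an observer `o`, a hub `h` behind a gate `G` carrying `c` glued relays and leaf relays
`i ∈ ι` with conditional gates `p i ≥ u`, and a glued block of `a ≤ j` relays behind a root gate `g`.  Conditioning on the hub gate
(`Quant.prodBernoulli_real_gate_split`) and moving `G` to the tie `g = G·u` (`Quant.affine_ge_linear_of_endpoints`), FAR at layer `j` for this tree is
the TWO-LEVEL inequality (TLB of the memo): with `X = c + #{open leaves}` under `prodBernoulli p`,
`P(X ≥ j+1) + g · P(j+1−a ≤ X ≤ j) ≥ u` whenever `(g/u)(c + Σ p_i) + a g > 2j`.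

This file proves the case `a = j` (the block is as large as the layer) — exactly the direction in which FAR is TIGHT (the two-block glue
family of the census, the `j/(j+1)` threshold, the V87/V97 sharpness families), and it turns out to be elementary:

* `Quant.count_le_window_bound` — pointwise, for every configuration: `X ≤ j·1[X ≥ 1] + (c + |ι| − j)·1[X ≥ j+1]`.
* `Quant.twoLevel_mean_le` — integrating: `c + Σ p_i + j·u ≤ ((c + Σ p_i)/u − j)·P(X ≥ j+1) + 2j·P(X ≥ 1)` for `0 < u ≤ p_i` and `ι`
  nonempty (uses only `E X = c + Σ p_i`, `P(X ≥ 1) ≥ u` and `(c + Σ p_i)/u ≥ c + |ι|`).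
* `Quant.twoLevel_topBlock` — **the top-block row**: if `0 < u ≤ p_i` (`ι` nonempty) and `(g/u)·(c + Σ p_i) + j·g > 2j` then
  `P(X ≥ j+1) + g · P(1 ≤ X ≤ j) ≥ u`.  No regime and no cardinality hypothesis; `g ≤ u` is not needed.
The general light block `a < j` is reduced in the memo (§5–§6) to one Poisson-binomial tail-ratio inequality; it is NOT proved here.
[cite: KozmaNitzan2024, Conjecture 3 (p. 15)] (the gluing rows served); the inequality itself is [this work].
-/

noncomputable section

namespace Summit.CriticalPhenomena.PercolationContinuityZ3.Theorems

open MeasureTheory Finset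
open Literature.Probability.LatticeModels
open Literature.Probability.Percolation (prodBernoulli_real_eq_sum_weight_ind)
open Literature.Probability.Percolation.BHK2006 (weight weight_nonneg)
open Literature.Probability.Percolation.DecisionTree (ind ind_of_mem ind_of_not_mem ind_nonneg)
open scoped Classical

namespace Quant

variable {ι : Type*} [Fintype ι]

/-- Pointwise window bound: for a count `X = c + #s ≤ c + |ι| =: M` and any `j`,
`X ≤ j·1[1 ≤ X] + (M − j)·1[j+1 ≤ X]` (if `X ≤ j` the first term covers it, otherwise `X ≤ M = j + (M − j)`). [folklore] -/
theorem count_le_window_bound (c j : ℕ) (s : Set ι) :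
    ((c + (univ.filter (fun i => i ∈ s)).card : ℕ) : ℝ) ≤
      (j : ℝ) * ind {s' : Set ι | 1 ≤ c + (univ.filter (fun i => i ∈ s')).card} s +
        ((c : ℝ) + Fintype.card ι - j) * ind {s' : Set ι | j + 1 ≤ c + (univ.filter (fun i => i ∈ s')).card} s := by
  set X : ℕ := c + (univ.filter (fun i => i ∈ s)).card with hX
  have hXM : X ≤ c + Fintype.card ι := by
    have : (univ.filter (fun i => i ∈ s)).card ≤ Fintype.card ι := by
      rw [← Finset.card_univ]; exact Finset.card_filter_le _ _
    omega
  have hXM' : (X : ℝ) ≤ (c : ℝ) + Fintype.card ι := by exact_mod_cast hXM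
  by_cases hj : j + 1 ≤ X
  · have h1 : 1 ≤ X := le_trans (by omega) hj
    rw [ind_of_mem (show s ∈ {s' : Set ι | 1 ≤ c + (univ.filter (fun i => i ∈ s')).card} from h1), mul_one,
      ind_of_mem (show s ∈ {s' : Set ι | j + 1 ≤ c + (univ.filter (fun i => i ∈ s')).card} from hj), mul_one]
    linarith
  · rw [ind_of_not_mem (show s ∉ {s' : Set ι | j + 1 ≤ c + (univ.filter (fun i => i ∈ s')).card} from hj),
      mul_zero, add_zero]
    by_cases h1 : 1 ≤ X
    · rw [ind_of_mem (show s ∈ {s' : Set ι | 1 ≤ c + (univ.filter (fun i => i ∈ s')).card} from h1), mul_one]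
      have : X ≤ j := by omega
      exact_mod_cast this
    · rw [ind_of_not_mem (show s ∉ {s' : Set ι | 1 ≤ c + (univ.filter (fun i => i ∈ s')).card} from h1), mul_zero]
      have h0 : X = 0 := by omega
      rw [h0, Nat.cast_zero]

/-- **Integrated window bound.**  For `X = c + #{open leaves}` under `prodBernoulli p` with `0 < u ≤ p i` for every leaf and at least
one leaf: `c + Σ_i p_i + j·u ≤ ((c + Σ_i p_i)/u − j)·P(X ≥ j+1) + 2j·P(X ≥ 1)`.  Proof: integrate `count_le_window_bound`
(`E X = c + Σ p_i`), then `c + |ι| ≤ (c + Σ p_i)/u` and `u ≤ P(X ≥ 1)`. [this work] -/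
theorem twoLevel_mean_le (p : ι → unitInterval) (c j : ℕ) (u : ℝ) (hu0 : 0 < u) (hup : ∀ i, u ≤ (p i : ℝ))
    (i₀ : ι) :
    (c : ℝ) + ∑ i, (p i : ℝ) + j * u ≤
      (((c : ℝ) + ∑ i, (p i : ℝ)) / u - j) *
          (prodBernoulli p).real {s : Set ι | j + 1 ≤ c + (univ.filter (fun i => i ∈ s)).card} +
        2 * j * (prodBernoulli p).real {s : Set ι | 1 ≤ c + (univ.filter (fun i => i ∈ s)).card} := by
  set μ := prodBernoulli p with hμ
  set W : Set ι → ℝ := weight (fun e => (p e : ℝ)) with hW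
  set E1 : Set (Set ι) := {s : Set ι | 1 ≤ c + (univ.filter (fun i => i ∈ s)).card} with hE1
  set Ej : Set (Set ι) := {s : Set ι | j + 1 ≤ c + (univ.filter (fun i => i ∈ s)).card} with hEj
  have hp0 : ∀ i, (0 : ℝ) ≤ p i := fun i => (p i).2.1
  have hp1 : ∀ i, (p i : ℝ) ≤ 1 := fun i => (p i).2.2
  have hW0 : ∀ s, 0 ≤ W s := fun s => weight_nonneg hp0 hp1 s
  -- total mass one and one-point marginals
  have hW1 : ∑ s, W s = 1 := by
    have h := prodBernoulli_real_eq_sum_weight_ind p (Set.univ : Set (Set ι))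
    rw [probReal_univ] at h
    rw [h]
    refine Finset.sum_congr rfl fun s _ => ?_
    rw [ind_of_mem (Set.mem_univ s), mul_one]
  have hW2 : ∀ i, ∑ s, W s * ind {s' : Set ι | i ∈ s'} s = p i := by
    intro i
    rw [← prodBernoulli_real_eq_sum_weight_ind p {s' : Set ι | i ∈ s'}, prodBernoulli_real_setOf_mem]
  -- the mean of the count: `Σ_s W s · (c + #s) = c + Σ p_i`
  have hmean : ∑ s, W s * ((c + (univ.filter (fun i => i ∈ s)).card : ℕ) : ℝ) = c + ∑ i, (p i : ℝ) := by
    have hcast : ∀ s : Set ι, ((c + (univ.filter (fun i => i ∈ s)).card : ℕ) : ℝ) =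
        (c : ℝ) + ∑ i, (1 : ℝ) * ind {s' : Set ι | i ∈ s'} s := by
      intro s
      have h := mass_cast_eq_sum_ind (fun _ : ι => (1 : ℕ)) s
      simp only [Finset.sum_const, smul_eq_mul, mul_one, Nat.cast_one] at h
      push_cast
      rw [← h]
    simp_rw [hcast, mul_add, Finset.sum_add_distrib, ← Finset.sum_mul, hW1, one_mul]
    congr 1
    simp_rw [Finset.mul_sum]
    rw [Finset.sum_comm]
    exact Finset.sum_congr rfl fun i _ => hW2 i
  -- the two tail probabilities as weighted sums
  have hT1 : μ.real E1 = ∑ s, W s * ind E1 s := prodBernoulli_real_eq_sum_weight_ind p E1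
  have hTj : μ.real Ej = ∑ s, W s * ind Ej s := prodBernoulli_real_eq_sum_weight_ind p Ej
  -- integrate the pointwise bound
  have hint : (c : ℝ) + ∑ i, (p i : ℝ) ≤ j * μ.real E1 + ((c : ℝ) + Fintype.card ι - j) * μ.real Ej := by
    rw [← hmean, hT1, hTj, Finset.mul_sum, Finset.mul_sum, ← Finset.sum_add_distrib]
    refine Finset.sum_le_sum fun s _ => ?_
    have h := count_le_window_bound (ι := ι) c j s
    have hWs := hW0 s
    calc W s * ((c + (univ.filter (fun i => i ∈ s)).card : ℕ) : ℝ)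
        ≤ W s * ((j : ℝ) * ind E1 s + ((c : ℝ) + Fintype.card ι - j) * ind Ej s) :=
          mul_le_mul_of_nonneg_left h hWs
      _ = j * (W s * ind E1 s) + ((c : ℝ) + Fintype.card ι - j) * (W s * ind Ej s) := by ring
  -- `P(X ≥ 1) ≥ u` via the leaf `i₀`
  have hT1u : u ≤ μ.real E1 := by
    have hsub : {s' : Set ι | i₀ ∈ s'} ⊆ E1 := by
      intro s hs
      have : 1 ≤ (univ.filter (fun i => i ∈ s)).card :=
        Finset.card_pos.2 ⟨i₀, Finset.mem_filter.2 ⟨Finset.mem_univ _, hs⟩⟩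
      show 1 ≤ c + (univ.filter (fun i => i ∈ s)).card
      omega
    calc u ≤ (p i₀ : ℝ) := hup i₀
      _ = μ.real {s' : Set ι | i₀ ∈ s'} := (prodBernoulli_real_setOf_mem p i₀).symm
      _ ≤ μ.real E1 := measureReal_mono hsub (measure_ne_top _ _)
  -- `c + |ι| ≤ (c + Σ p_i)/u`
  have hcard : (c : ℝ) + Fintype.card ι ≤ ((c : ℝ) + ∑ i, (p i : ℝ)) / u := by
    rw [le_div_iff₀ hu0]
    have h1 : (Fintype.card ι : ℝ) * u ≤ ∑ i, (p i : ℝ) := by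
      calc (Fintype.card ι : ℝ) * u = ∑ _i : ι, u := by rw [Finset.sum_const, Finset.card_univ, nsmul_eq_mul]
        _ ≤ ∑ i, (p i : ℝ) := Finset.sum_le_sum fun i _ => hup i
    have h2 : (c : ℝ) * u ≤ c := by
      have hu1 : u ≤ 1 := le_trans (hup i₀) (hp1 i₀)
      nlinarith [Nat.cast_nonneg (α := ℝ) c]
    nlinarith
  have hTj0 : 0 ≤ μ.real Ej := measureReal_nonneg
  have hj0 : (0 : ℝ) ≤ j := Nat.cast_nonneg j
  -- assemble
  have hstep : ((c : ℝ) + Fintype.card ι - j) * μ.real Ej ≤ (((c : ℝ) + ∑ i, (p i : ℝ)) / u - j) * μ.real Ej :=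
    mul_le_mul_of_nonneg_right (by linarith) hTj0
  nlinarith [hint, hstep, hT1u, mul_le_mul_of_nonneg_left hT1u hj0]

/-- **The top-block two-level row (`a = j`).**  For `X = c + #{open leaves}` under `prodBernoulli p` with `0 < u ≤ p i` (at least one leaf),
any real `g` and any layer `j`: if `(g/u)·(c + Σ_i p_i) + j·g > 2j` then `P(X ≥ j+1) + g · P(1 ≤ X ≤ j) ≥ u`.
Tree reading (memo TLB-NOTES §5): FAR at layer `j` for the tree "hub at gate `G = g/u` carrying `c` glued relays and the leaves `ι`, plus a root
block of `j` glued relays at gate `g`", at the tie — the direction in which the far-relay row is tight.  Proof: `twoLevel_mean_le` gives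
`V·P(X ≥ j+1) + 2j·P(1 ≤ X ≤ j) + 2j·P(X ≥ j+1) ≥ u·V + 2j·P(X ≥ j+1)`-type bookkeeping with `V = (c + Σ p_i)/u + j`, i.e.
`V·A + 2j·B ≥ u·V` for `A = P(X ≥ j+1)`, `B = P(1 ≤ X ≤ j)`; and `g·V > 2j`. [this work] -/
theorem twoLevel_topBlock (p : ι → unitInterval) (c j : ℕ) (u g : ℝ) (hu0 : 0 < u) (hup : ∀ i, u ≤ (p i : ℝ))
    (i₀ : ι) (hmean : (2 * j : ℝ) < g / u * ((c : ℝ) + ∑ i, (p i : ℝ)) + j * g) :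
    u ≤ (prodBernoulli p).real {s : Set ι | j + 1 ≤ c + (univ.filter (fun i => i ∈ s)).card} +
      g * (prodBernoulli p).real {s : Set ι | 1 ≤ c + (univ.filter (fun i => i ∈ s)).card ∧
        c + (univ.filter (fun i => i ∈ s)).card ≤ j} := by
  set μ := prodBernoulli p with hμ
  set E1 : Set (Set ι) := {s : Set ι | 1 ≤ c + (univ.filter (fun i => i ∈ s)).card} with hE1
  set Ej : Set (Set ι) := {s : Set ι | j + 1 ≤ c + (univ.filter (fun i => i ∈ s)).card} with hEj
  set Ew : Set (Set ι) := {s : Set ι | 1 ≤ c + (univ.filter (fun i => i ∈ s)).card ∧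
      c + (univ.filter (fun i => i ∈ s)).card ≤ j} with hEw
  have hmeas : ∀ S : Set (Set ι), MeasurableSet S := fun S => MeasurableSet.of_discrete
  -- `P(X ≥ 1) = P(X ≥ j+1) + P(1 ≤ X ≤ j)`
  have hsplit : μ.real E1 = μ.real Ej + μ.real Ew := by
    have hunion : E1 = Ej ∪ Ew := by
      ext s
      simp only [hE1, hEj, hEw, Set.mem_setOf_eq, Set.mem_union]
      constructor
      · intro h; by_cases hj : j + 1 ≤ c + (univ.filter (fun i => i ∈ s)).card
        · exact Or.inl hj
        · exact Or.inr ⟨h, by omega⟩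
      · rintro (h | h) <;> omega
    have hdisj : Disjoint Ej Ew := by
      rw [Set.disjoint_left]
      intro s hs hs'
      simp only [hEj, hEw, Set.mem_setOf_eq] at hs hs'
      omega
    rw [hunion, measureReal_union hdisj (hmeas _)]
  have hmain := twoLevel_mean_le p c j u hu0 hup i₀
  rw [← hμ] at hmain
  set A := μ.real Ej with hA
  set B := μ.real Ew with hB
  set S : ℝ := (c : ℝ) + ∑ i, (p i : ℝ) with hS
  have hA0 : 0 ≤ A := measureReal_nonneg
  have hB0 : 0 ≤ B := measureReal_nonneg
  -- `V A + 2j B ≥ u V` with `V = S/u + j`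
  have hV : (S / u + j) * A + 2 * j * B ≥ u * (S / u + j) := by
    have h1 : S + j * u ≤ (S / u - j) * A + 2 * j * (A + B) := by rw [← hsplit]; exact hmain
    have h2 : u * (S / u + j) = S + j * u := by field_simp
    nlinarith [h1, h2]
  have hVpos : 0 < S / u + j := by
    have hS0 : 0 < S / u + j ∨ S / u + j ≤ 0 := lt_or_ge 0 _ |>.imp id id
    rcases hS0 with h | h
    · exact h
    · -- impossible: then `g·(S/u + j) ≤ 0 < 2j`-type contradiction with `hmean` unless `j = 0`, where `V = S/u ≥ 0`...
      have hSu : 0 ≤ S / u := div_nonneg (by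
        have : 0 ≤ ∑ i, (p i : ℝ) := Finset.sum_nonneg fun i _ => (p i).2.1
        rw [hS]; positivity) hu0.le
      have hj0 : (j : ℝ) = 0 := by
        have : (0 : ℝ) ≤ j := Nat.cast_nonneg j
        linarith
      have hS0' : S / u = 0 := by linarith
      -- then the hypothesis reads `0 < 0`
      exfalso
      have : g / u * S + j * g = g * (S / u + j) := by ring
      rw [this, hS0', hj0] at hmean
      simp at hmean
  -- conclude: `A + g B ≥ A + (2j/V) B ≥ u`
  have hgV : 2 * j ≤ g * (S / u + j) := by
    have : g / u * S + j * g = g * (S / u + j) := by ring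
    linarith [hmean, this]
  have key : u * (S / u + j) ≤ (S / u + j) * (A + g * B) := by
    have : (S / u + j) * (A + g * B) = (S / u + j) * A + g * (S / u + j) * B := by ring
    rw [this]
    nlinarith [hV, hgV, hB0]
  have := le_of_mul_le_mul_right (by linarith [key] : u * (S / u + j) ≤ (A + g * B) * (S / u + j)) hVpos
  linarith [this]

/-- **Tree form of the top-block row (both cells of the tie, no affinity argument needed).**  Hub gate `G > 0`, block gate `g > 0`,
leaves with conditional gates `p i ≥ p i₀` (`i₀` a least reliable leaf), `X = c + #{open leaves}`, `A = P(X ≥ j+1)`, `B = P(1 ≤ X ≤ j)`.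
If the tree "hub (`c` glued relays + leaves) + root block of `j` relays" satisfies the FAR mean hypothesis at layer `j`,
`2j < G·(c + Σ p_i) + j·g`, then `G·(A + g·B) ≥ min(g, G·p i₀)` — i.e. `P(N ≥ j+1) ≥` the least marginal, since given the configuration of
the two root gates `P(N ≥ j+1) = G·(A + g·B)` (`N = j·ε_g + ε_G·X`).  Apply `twoLevel_topBlock` with `u = g/G` (block least likely) or
`u = p i₀` (leaf least likely). [this work] -/
theorem twoLevel_topBlock_tree (p : ι → unitInterval) (c j : ℕ) (G g : ℝ) (hG0 : 0 < G) (hg0 : 0 < g)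
    (i₀ : ι) (hmin : ∀ i, (p i₀ : ℝ) ≤ p i)
    (hEN : (2 * j : ℝ) < G * ((c : ℝ) + ∑ i, (p i : ℝ)) + j * g) :
    min g (G * p i₀) ≤
      G * ((prodBernoulli p).real {s : Set ι | j + 1 ≤ c + (univ.filter (fun i => i ∈ s)).card} +
        g * (prodBernoulli p).real {s : Set ι | 1 ≤ c + (univ.filter (fun i => i ∈ s)).card ∧
          c + (univ.filter (fun i => i ∈ s)).card ≤ j}) := by
  set A := (prodBernoulli p).real {s : Set ι | j + 1 ≤ c + (univ.filter (fun i => i ∈ s)).card} with hA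
  set B := (prodBernoulli p).real {s : Set ι | 1 ≤ c + (univ.filter (fun i => i ∈ s)).card ∧
    c + (univ.filter (fun i => i ∈ s)).card ≤ j} with hB
  set S : ℝ := (c : ℝ) + ∑ i, (p i : ℝ) with hS
  have hA0 : 0 ≤ A := measureReal_nonneg
  have hB0 : 0 ≤ B := measureReal_nonneg
  have hS0 : 0 ≤ S := by
    have : 0 ≤ ∑ i, (p i : ℝ) := Finset.sum_nonneg fun i _ => (p i).2.1
    rw [hS]; positivity
  by_cases hcase : g ≤ G * p i₀
  · -- the block is least likely: `u = g / G`
    rw [min_eq_left hcase]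
    have hu0 : 0 < g / G := div_pos hg0 hG0
    have hup : ∀ i, g / G ≤ (p i : ℝ) := fun i => by
      rw [div_le_iff₀ hG0]; nlinarith [hmin i, hcase]
    have hmean : (2 * j : ℝ) < (g / (g / G)) * S + j * g := by
      have : g / (g / G) = G := by field_simp
      rw [this]; exact hEN
    have h := twoLevel_topBlock p c j (g / G) g hu0 hup i₀ hmean
    rw [← hA, ← hB] at h
    have : G * (g / G) = g := by field_simp
    nlinarith [h, this, hG0.le]
  · -- leaf `i₀` is least likely: `u = p i₀`
    push Not at hcase
    rw [min_eq_right hcase.le]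
    by_cases hp0 : (p i₀ : ℝ) = 0
    · rw [hp0, mul_zero]; exact mul_nonneg hG0.le (add_nonneg hA0 (mul_nonneg hg0.le hB0))
    · have hu0 : 0 < (p i₀ : ℝ) := lt_of_le_of_ne (p i₀).2.1 (Ne.symm hp0)
      have hgu : G < g / p i₀ := by rw [lt_div_iff₀ hu0]; linarith
      have hmean : (2 * j : ℝ) < (g / p i₀) * S + j * g := by
        have : G * S ≤ (g / p i₀) * S := mul_le_mul_of_nonneg_right hgu.le hS0
        linarith
      have h := twoLevel_topBlock p c j (p i₀) g hu0 hmin i₀ hmean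
      rw [← hA, ← hB] at h
      nlinarith [h, hG0.le]

end Quant

end Summit.CriticalPhenomena.PercolationContinuityZ3.Theorems

end
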